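import Literature.InformationTheory.QuantumCodes.ToricCodeDistance
import Literature.InformationTheory.QuantumCodes.ToricCodeMixedChannelThreshold
import Literature.InformationTheory.QuantumCodes.CSSMixedChannelConverse
import Literature.InformationTheory.QuantumCodes.CSSEquivalenceNoise
import Literature.InformationTheory.QuantumCodes.ToricCodePhenomenological
import Literature.InformationTheory.QuantumCodes.CSSPhenomenologicalConverse
import HarnessLib

/-!
# The `L × L` toric code on the lattice: the `X ↔ Z` exchange is the lattice duality ⇒ certified CEILINGS
# `y_c ≤ 1/2`, `p_c ≤ 1/4` (every decoder), `p₀(y) ≤ (1 − 2y)/(4(1 − y))` for the LATTICE families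

Dennis–Kitaev–Landahl–Preskill [DennisEtAl2002] §3.1: the toric code is self-dual — exchanging stars and plaquettes
is the passage to the dual lattice. In the tree this is the pair of submatrix identities
`plaquetteMatrix_eq_submatrix` / `starMatrix_eq_submatrix` (`ToricCodeDistance.lean`, used there for `d^X = d^Z`),
so `(toricCode L).swap` IS `toricCode L` re-indexed (`toricCode_swap_eq_reindex`, `CSSCode.eq_reindex_of_submatrix`),
and `CSSEquivalenceNoise.lean` transports the erasure law: the two sectors of the LATTICE toric code have the same
erasure-uncorrectability probability (`uncorrectableProb_dual`). Consequently every converse mechanism of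
`CSSThresholdConverses.lean` / `CSSMixedChannelConverse.lean` gives one-sector statements for the lattice
families of `ToricCodeThreshold.lean`, `ToricCodeErasureThreshold.lean`, `ToricCodeMixedChannelThreshold.lean`
(the objects of the DKLP / Stace–Barrett–Doherty theorems of the tree), valid for EVERY decoder:

* `toricCode_k_pos` (`k ≥ 1`); `half_le_uncorrectableProb_half`: `1/2 ≤ P_{1/2}[loss uncorrectable]`;
  **`1/3 ≤ y_c ≤ 1/2`** for `erasureFamily` (`erasure_threshold_le_half`, `erasure_accuracyThreshold_mem`; printed
  value `.5` by bond percolation, Stace–Barrett–Doherty — NOT proved);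
* `quarter_le_failureProb_quarter`: every decoder `D : ZDecoder L` has `failureProb L D (1/4) ≥ 1/4`; hence
  **`p_c ≤ 1/4` for EVERY decoder family** of the DKLP family `(L, p) ↦ failureProb (L+1) (D L) p`
  (`capacity_threshold_le_quarter`; numerics `≈ .103` MWPM / `.109` optimal — VALIDATED values);
* loss + flips: `quarter_le_mixedFailureProb` on the curve `y + 2p(1−y) = 1/2` and the **ceiling curve**
  `a ≤ (1 − 2y)/(4(1 − y))` for every certified flip-threshold lower bound of `mixedFamily D y`, `0 ≤ y < 1/2`, EVERY
  erasure-aware decoder family (`mixed_threshold_le`) — the other side of `mixedThreshold_of_sawCountBound`;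
* phenomenological noise (appended): the DKLP space-time model of `ToricCodePhenomenological.lean` IS the generic
  `CSSPhenom` model at `(starMatrix L, boundaries L)` (`phenomFailureProb_eq_css`, definitional), so the genie bound of
  `CSSPhenomenologicalConverse.lean` gives `1/4 ≤ phenomFailureProb L T D (1/4) (1/4)` for EVERY space-time decoder and
  every `T ≥ 1` (`quarter_le_phenomFailureProb_quarter`) and **`p_c^{ph} ≤ 1/4` for every space-time decoder family**
  of the DKLP phenomenological family `(L, p) ↦ phenomFailureProb (L+1) (T L) (D L) p p` (`phenom_threshold_le_quarter`).

Kernel axioms only; no named fact; no `native_decide`; no new definition.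

## References

* [DennisEtAl2002] J. Math. Phys. 43 (2002) 4452, §3.1 (chunk p0008 L5: "cycle on the lattice or dual lattice"),
  §4.6 (p_c), §5.2 (Prob_fail).
* [StaceBarrettDoherty2009] PRL 102 (2009) 200501, pp. 1–2 (p_loss < .5; the (p_loss, p_com) boundary).
* [RichardsonUrbanke2008] Modern Coding Theory, Lemma 4.78 (Erasure Decomposition Lemma).
* [DumerKovalevPryadko2015] PRL 115 (2015) 050502, Thm 2 and p. 5 (y_c* = 1/3, p_c* ≈ .029).
-/

namespace Literature.InformationTheory.QuantumCodes

namespace ToricCode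

open Finset Matrix Filter Topology

variable {L : ℕ}

/-! ### Self-duality as a re-indexing -/

/-- **The `X ↔ Z` exchange of the lattice toric code is the toric code re-indexed along the lattice duality**
(`σ = dualEdge`, `ρ = −` on sites/plaquettes). [cite: DennisEtAl2002, §3.1 (lattice and dual lattice)] -/
theorem toricCode_swap_eq_reindex [NeZero L] :
    (toricCode L).swap =
      (toricCode L).reindex (Equiv.neg (Vertex L)).symm (Equiv.neg (Vertex L)).symm (dualEdge L).symm :=
  CSSCode.eq_reindex_of_submatrix (C := toricCode L) (C' := (toricCode L).swap) (ρX := Equiv.neg (Vertex L))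
    (ρZ := Equiv.neg (Vertex L)) (σ := dualEdge L) plaquetteMatrix_eq_submatrix starMatrix_eq_submatrix

/-- The toric code encodes something: `k ≥ 1` (indeed `d^X = L ≠ 0`). [cite: DennisEtAl2002, §3.1 (two encoded qubits)] -/
theorem toricCode_k_pos [NeZero L] : 0 < (toricCode L).k := by
  rw [pos_iff_ne_zero, Ne, CSSCode.k_eq_zero_iff_dX_eq_zero, toricCode_dX]
  exact NeZero.ne L

/-- **The two sectors of the lattice toric code have the same loss behaviour**: the probability that an
independent loss pattern of rate `y` is uncorrectable for bit flips (plaquette syndrome, `X`-stabilizers = stars)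
equals the one for phase flips (`cycles`, `boundaries`). [cite: StaceBarrettDoherty2009, p. 2 (losses affect X̄ and Z̄ alike); DennisEtAl2002, §3.1] -/
theorem uncorrectableProb_dual [NeZero L] (y : ℝ) :
    ErasureDecoder.uncorrectableProb {x : Chain L | (toricCode L).HZ *ᵥ x = 0}
        ((toricCode L).rowSpX : Set (Chain L)) y =
      ErasureDecoder.uncorrectableProb (cycles L) (boundaries L) y := by
  change ErasureDecoder.uncorrectableProb {x : Chain L | (toricCode L).swap.HX *ᵥ x = 0}
      ((toricCode L).swap.rowSpZ : Set (Chain L)) y =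
    ErasureDecoder.uncorrectableProb {x : Chain L | (toricCode L).HX *ᵥ x = 0} ((toricCode L).rowSpZ : Set (Chain L)) y
  rw [toricCode_swap_eq_reindex, CSSCode.uncorrectableProb_reindex]

/-! ### Losses: `1/3 ≤ y_c ≤ 1/2` -/

/-- **At loss rate `1/2` the loss pattern of the toric code is uncorrectable with probability `≥ 1/2`** (every
`L`; hence every consistent loss decoder fails with probability `≥ 1/2`).
[cite: StaceBarrettDoherty2009, p. 2 (p_loss < 0.5, no-cloning)] -/
theorem half_le_uncorrectableProb_half [NeZero L] :
    1 / 2 ≤ ErasureDecoder.uncorrectableProb (cycles L) (boundaries L) (1 / 2) := by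
  have h := (toricCode L).one_le_uncorrectableProb_add toricCode_k_pos (y := 1 / 2) (by norm_num) (by norm_num)
  rw [show (1 : ℝ) - 1 / 2 = 1 / 2 by norm_num, uncorrectableProb_dual] at h
  change 1 ≤ ErasureDecoder.uncorrectableProb (cycles L) (boundaries L) (1 / 2) +
    ErasureDecoder.uncorrectableProb (cycles L) (boundaries L) (1 / 2) at h
  linarith

/-- **Toric loss threshold `≤ 1/2`**: no number above `1/2` is a certified loss-threshold lower bound of the toric
codes («the maximum tolerable loss rate is 50%» is the printed VALUE; the tree certifies `1/3 ≤ y_c ≤ 1/2`).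
[cite: StaceBarrettDoherty2009, p. 1 (abstract) and p. 2] -/
theorem erasure_threshold_le_half {a : ℝ} (ha : IsThresholdLowerBound erasureFamily a) : a ≤ 1 / 2 := by
  by_contra h
  push Not at h
  refine not_belowThreshold_of_le (c := 1 / 2) (by norm_num) (fun L => ?_) (ha (1 / 2) (by norm_num) h)
  exact half_le_uncorrectableProb_half (L := L + 1)

/-- **`1/3 ≤ y_c ≤ 1/2`** for the loss accuracy threshold of the lattice toric codes — a certified two-sided interval.
[cite: StaceBarrettDoherty2009, p. 2 (p_loss < 0.5); DumerKovalevPryadko2015, p. 5 (y_c* = 1/3)] -/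
theorem erasure_accuracyThreshold_mem :
    (1 / 3 : ℝ) ≤ accuracyThreshold erasureFamily ∧ accuracyThreshold erasureFamily ≤ 1 / 2 :=
  ⟨le_accuracyThreshold erasureThreshold_three (by norm_num),
    erasure_threshold_le_half (isThresholdLowerBound_accuracyThreshold _)⟩

/-! ### Independent flips: `p_c ≤ 1/4` for every decoder -/

open Classical in
/-- **At flip rate `1/4` every decoder of the toric code fails with probability `≥ 1/4`** (flips at rate `1/4` are
losses at rate `1/2` plus fair coins; both sectors share the loss behaviour).
[cite: RichardsonUrbanke2008, Lemma 4.78 (Erasure Decomposition Lemma); StaceBarrettDoherty2009, p. 2] -/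
theorem quarter_le_failureProb_quarter [NeZero L] (D : ZDecoder L) : 1 / 4 ≤ failureProb L D (1 / 4) := by
  have h := uncorrectableProb_two_mul_le (starMatrix L) (rowSpace (plaquetteMatrix L)) D (p := 1 / 4)
    (by norm_num) (by norm_num)
  rw [show (2 : ℝ) * (1 / 4) = 1 / 2 by norm_num] at h
  have h2 := half_le_uncorrectableProb_half (L := L)
  change 1 / 2 ≤ ErasureDecoder.uncorrectableProb {x : Chain L | starMatrix L *ᵥ x = 0}
    (rowSpace (plaquetteMatrix L) : Set (Chain L)) (1 / 2) at h2
  change 1 / 4 ≤ ∑ e ∈ univ.filter (fun e : Chain L => ¬ D.Corrects (fun e => starMatrix L *ᵥ e)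
    (rowSpace (plaquetteMatrix L) : Set (Chain L)) e), bernoulliWeight (1 / 4) (supp e)
  linarith

open Classical in
/-- **Toric code-capacity threshold `≤ 1/4` for EVERY decoder family** (DKLP family `(L, p) ↦ failureProb (L+1) (D L) p`;
maximum likelihood included). [cite: RichardsonUrbanke2008, Lemma 4.78; DennisEtAl2002, §4.6 (p_c)] -/
theorem capacity_threshold_le_quarter (D : (L : ℕ) → ZDecoder (L + 1)) {a : ℝ}
    (ha : IsThresholdLowerBound (fun L p => failureProb (L + 1) (D L) p) a) : a ≤ 1 / 4 := by
  by_contra h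
  push Not at h
  refine not_belowThreshold_of_le (c := 1 / 4) (by norm_num) (fun L => ?_) (ha (1 / 4) (by norm_num) h)
  exact quarter_le_failureProb_quarter (D L)

open Classical in
/-- Accuracy-threshold form: `p_c ≤ 1/4` for the DKLP family of every decoder family.
[cite: DennisEtAl2002, §4.6 (p_c); RichardsonUrbanke2008, Lemma 4.78] -/
theorem capacity_accuracyThreshold_le_quarter (D : (L : ℕ) → ZDecoder (L + 1)) :
    accuracyThreshold (fun L p => failureProb (L + 1) (D L) p) ≤ 1 / 4 :=
  capacity_threshold_le_quarter D (isThresholdLowerBound_accuracyThreshold _)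

/-! ### Losses and flips: the ceiling curve -/

open Classical in
/-- **On the curve `y + 2p(1−y) = 1/2` every erasure-aware decoder of the toric code fails with probability `≥ 1/4`.**
[cite: StaceBarrettDoherty2009, p. 2 and Fig. 2; RichardsonUrbanke2008, Lemma 4.78] -/
theorem quarter_le_mixedFailureProb [NeZero L] (D : ErasureDecoder (Edge L) (Syndrome L)) {y p : ℝ} (hy0 : 0 ≤ y)
    (hy1 : y ≤ 1) (hp0 : 0 ≤ p) (hp : p ≤ 1 / 2) (hcurve : y + (1 - y) * (2 * p) = 1 / 2) :
    1 / 4 ≤ mixedFailureProb (starMatrix L) (boundaries L) D y p := by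
  have h := uncorrectableProb_le_two_mul_mixedFailureProb (starMatrix L) (rowSpace (plaquetteMatrix L)) D
    hy0 hy1 hp0 hp
  rw [hcurve] at h
  have h2 := half_le_uncorrectableProb_half (L := L)
  change 1 / 2 ≤ ErasureDecoder.uncorrectableProb {x : Chain L | starMatrix L *ᵥ x = 0}
    (rowSpace (plaquetteMatrix L) : Set (Chain L)) (1 / 2) at h2
  change 1 / 4 ≤ mixedFailureProb (starMatrix L) (rowSpace (plaquetteMatrix L) : Set (Chain L)) D y p
  linarith

open Classical in
/-- **THE CEILING CURVE OF THE TORIC LOSS–ERROR PHASE DIAGRAM, every decoder**: at loss rate `0 ≤ y < 1/2`,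
every certified flip-threshold lower bound `a` of `mixedFamily D y` (ANY erasure-aware decoder family) satisfies
`a ≤ (1 − 2y)/(4(1 − y))` (`y = 0`: `1/4`; `y → 1/2`: `→ 0`). The certified FLOOR is `mixedThreshold_of_sawCountBound`
(`μ·Υ_CSS(y,p) < 1`); Stace–Barrett–Doherty's numerical boundary lies in between.
[cite: StaceBarrettDoherty2009, p. 2 and Fig. 2; RichardsonUrbanke2008, Lemma 4.78] -/
theorem mixed_threshold_le (D : (L : ℕ) → ErasureDecoder (Edge (L + 1)) (Syndrome (L + 1))) {y : ℝ}
    (hy0 : 0 ≤ y) (hy : y < 1 / 2) {a : ℝ} (ha : IsThresholdLowerBound (mixedFamily D y) a) :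
    a ≤ (1 - 2 * y) / (4 * (1 - y)) := by
  by_contra h
  push Not at h
  have hp0 : 0 ≤ (1 - 2 * y) / (4 * (1 - y)) := div_nonneg (by linarith) (by linarith)
  have hp : (1 - 2 * y) / (4 * (1 - y)) ≤ 1 / 2 := by
    rw [div_le_iff₀ (by linarith)]
    linarith
  have hcurve : y + (1 - y) * (2 * ((1 - 2 * y) / (4 * (1 - y)))) = 1 / 2 := by
    have hy1 : (1 - y) ≠ 0 := by linarith
    field_simp
    ring
  refine not_belowThreshold_of_le (c := 1 / 4) (by norm_num) (fun L => ?_) (ha _ hp0 h)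
  exact quarter_le_mixedFailureProb (L := L + 1) (D L) hy0 (by linarith) hp0 hp hcurve

open Classical in
/-- Accuracy-threshold form of the ceiling curve: `p_c^{mixed}(y) ≤ (1 − 2y)/(4(1 − y))` for the lattice toric codes,
`0 ≤ y < 1/2`, every erasure-aware decoder family. [cite: StaceBarrettDoherty2009, p. 2 and Fig. 2] -/
theorem mixed_accuracyThreshold_le (D : (L : ℕ) → ErasureDecoder (Edge (L + 1)) (Syndrome (L + 1))) {y : ℝ}
    (hy0 : 0 ≤ y) (hy : y < 1 / 2) :
    accuracyThreshold (mixedFamily D y) ≤ (1 - 2 * y) / (4 * (1 - y)) :=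
  mixed_threshold_le D hy0 hy (isThresholdLowerBound_accuracyThreshold _)

/-! ### Phenomenological noise: the DKLP space-time model is the generic one ⇒ `p_c^{ph} ≤ 1/4` -/

section Phenomenological

variable {T : ℕ}

/-- **The toric space-time model IS the generic CSS space-time model** at `H = starMatrix L`, `SX = boundaries L`
(same fault locations, boundary matrix, projection and harmless set — definitionally).
[cite: DennisEtAl2002, §4.2–4.3 and §5.2 (the model); DumerKovalevPryadko2015, p. 5 (its CSS generalisation)] -/
theorem phenomFailureProb_eq_css [NeZero L] (D : STDecoder L T) (p q : ℝ) :
    phenomFailureProb L T D p q = CSSPhenom.phenomFailureProb (starMatrix L) T (boundaries L) D p q := rfl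

/-- **At `p = q = 1/4` every space-time decoder of the toric code fails with probability `≥ 1/4`** (every `L`,
every number of rounds `T ≥ 1`). [cite: DennisEtAl2002, §5.2–5.3 (Prob_fail, p = q); RichardsonUrbanke2008, Lemma 4.78] -/
theorem quarter_le_phenomFailureProb_quarter [NeZero L] (D : STDecoder L T) (t₀ : Fin T) :
    1 / 4 ≤ phenomFailureProb L T D (1 / 4) (1 / 4) := by
  rw [phenomFailureProb_eq_css]
  exact (toricCode L).quarter_le_zPhenom_quarter_of_symm toricCode_k_pos (fun y => uncorrectableProb_dual y) D t₀

/-- At `p = q = 1/2` every space-time decoder of the toric code fails with probability `≥ 1/2`.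
[cite: DennisEtAl2002, §5.2–5.3; RichardsonUrbanke2008, Lemma 4.78] -/
theorem half_le_phenomFailureProb_half [NeZero L] (D : STDecoder L T) (t₀ : Fin T) :
    1 / 2 ≤ phenomFailureProb L T D (1 / 2) (1 / 2) := by
  rw [phenomFailureProb_eq_css]
  exact (toricCode L).half_le_zPhenom_half toricCode_k_pos D t₀

/-- **Toric phenomenological threshold `≤ 1/4` for EVERY space-time decoder family** and every schedule of rounds
`T_L ≥ 1` (the DKLP family `(L, p) ↦ phenomFailureProb (L+1) (T L) (D L) p p`; numerics `≈ .029`–`.033` —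
VALIDATED values; certified floor `.0106` in `Summits/…/ToricCodePhenomenologicalUnconditional.lean`).
[cite: DennisEtAl2002, §4.6 (p_c) and §5.3 (p = q); RichardsonUrbanke2008, Lemma 4.78] -/
theorem phenom_threshold_le_quarter (T : ℕ → ℕ) (hT : ∀ L, 0 < T L) (D : (L : ℕ) → STDecoder (L + 1) (T L)) {a : ℝ}
    (ha : IsThresholdLowerBound (fun L p => phenomFailureProb (L + 1) (T L) (D L) p p) a) : a ≤ 1 / 4 := by
  by_contra h
  push Not at h
  refine not_belowThreshold_of_le (c := 1 / 4) (by norm_num) (fun L => ?_) (ha (1 / 4) (by norm_num) h)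
  exact quarter_le_phenomFailureProb_quarter (D L) ⟨0, hT L⟩

/-- Accuracy-threshold form: `p_c^{ph} ≤ 1/4` for the toric DKLP phenomenological family of every space-time
decoder family, `T_L ≥ 1`. [cite: DennisEtAl2002, §4.6 and §5.3] -/
theorem phenom_accuracyThreshold_le_quarter (T : ℕ → ℕ) (hT : ∀ L, 0 < T L)
    (D : (L : ℕ) → STDecoder (L + 1) (T L)) :
    accuracyThreshold (fun L p => phenomFailureProb (L + 1) (T L) (D L) p p) ≤ 1 / 4 :=
  phenom_threshold_le_quarter T hT D (isThresholdLowerBound_accuracyThreshold _)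

end Phenomenological

end ToricCode

end Literature.InformationTheory.QuantumCodes
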